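import Mathlib
import Summits.HodgeConjecture.FermatCycles.HodgeFermatThreeFibre

/-!
# The row p = 3 of THEOREM L, step 2: the pointwise lemma at 3 — part 1 (`HodgeFermat/ThreePointwise.lean`; HF-G30b)

Tree copy (part 1 of 2) of the module `HodgeFermat/ThreePointwise.lean` of the sibling cell's standalone package
`run/shared/lean/pub/pub-hodgefermat/lean/HodgeFermat/` (460 lines, sha256 `48358d6edf25f8e6…`), source lines 22–211 (§§1–2: residues, the doubling identity, the unit case `unit_case`).
Filed by cell `pub-hfermat`, seat prover-1 gen-3, on the COORDINATOR KEEPER RULING of 2026-08-25 (gem sweep H1: take the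
off-gate kernel theorem `thmFstar` through the gate) — here THEOREM F* of `tables/DPRIME-THEOREM.md` §9 IN FULL, i.e.
PROPOSITION D′(3N) and the descent (`HodgeFermat/PropDPrimeNFinal.lean`, GATE HF-G34), the last off-gate form of THEOREM F*
(its first two forms, `DecodingFinal.thmFstar` = F* at the prime levels and `ThmFstarNFinal.thmFstar` = F*(3N), landed on
2026-08-25 as `HodgeFermatThmFstar.lean` / `HodgeFermatThmFstarN.lean`, seats prover-1 gen-0 / gen-2); this file is one link of
the import closure of `PropDPrimeNFinal.propDprime` (the sibling's KR-free chain: THEOREM L, COROLLARY M, THEOREM D6,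
THEOREM U⁺, THEOREM KR6, THEOREM Z3U) on top of those landed chains.  The source module is the sibling's hub-checked module of
record (pub-hodgefermat `CERT.md` l.960, GATE HF-G30b); its declarations are copied VERBATIM.
Deviations from the source module, exhaustively: the `import` lines (tree modules `Summits.HodgeConjecture.FermatCycles.
HodgeFermat*` instead of `HodgeFermat.*`); this module docstring; one-line docstrings added (gate lint) to `mid_mul`; the file ends at source l.211 with an `end` line (part 2 = `HodgeFermatThreePointwiseB.lean`).
Every other line — in particular every declaration's statement and proof — is byte-identical to the source.
HONEST FRAMING: explicit algebraic cycles for specific Hodge classes on Fermat/Delsarte varieties; residual open instances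
listed; no claim on general Hodge.  (This file is arithmetic of CM types / finite combinatorics / analytic number theory
of the sibling's KR-free programme; it claims nothing about cycles.)

The source module's docstring (ThreePointwise.lean l.3–20), verbatim:

## KR-FREE PROGRAMME — the row p = 3 of THEOREM L, step 2: the pointwise lemma at 3

**LEMMA P3.**  `n` squarefree, odd, `3 ∤ n`; `u, v ≢ 0 (mod n)`; if for every unit `t̄` of `ℤ/n`
`⟨t u⟩_n ∈ M_n ⟺ ⟨t v⟩_n ∈ M_n` (`M_n` the middle third), then `u ≡ ± v (mod n)`   [`pointwise₃`].
 (a) `u, v` units [`unit_case`]: `w = v u⁻¹`; `M_n ∩ (ℤ/n)ˣ` is `w`-invariant; `1 ∉ M_n` gives `3w < n` (or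
     `3(n − w) < n`), and the doubling argument [`doubling`] — `2^(j+1)` is a unit below `n/3` as long as
     `3·2^(j+1) < n`, so `3·2^j·w < n` by induction — gives `w = 1` (resp. `n − w = 1`).
 (b) a prime `p ∣ n` dividing both `u` and `v`: pull back to level `n/p` (units lift, `lift_unit`) and induct.
 (c) a prime `p ∣ n` dividing exactly one of them [`one_sided`]: on the fibre of `(ℤ/n)ˣ → (ℤ/(n/p))ˣ` over `t̄'`
     the `p`-divisible side is constant while the other side runs through `n'B + σ` (`σ = ⟨t'u⟩_{n'}`, all digits
     `B < p` but the one non-unit lift, LEMMA N's `liftB_image`); digits `0`/`p − 1` lie outside `M_n`, digit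
     `⌊(n − 3σ)/3n'⌋ + 1` (and the next one when `p ≥ 7`) inside — a contradiction unless `p = 5` and `σ ∈ M_{n'}`
     [`fibre_step`]; the fibres over `1̄` and `2̄` cannot both be exceptional.

Generation 30 (HF-G30b) of the hodge-fermat build.  LIGHT module (imports `ThreeFibre`).  No `sorry`, no `decide`,
no axiom beyond [propext, Classical.choice, Quot.sound].
-/

set_option autoImplicit false

namespace HodgeFermat.KRFree.ThreePointwise

open Finset HodgeFermat.KRFree.LemmaN HodgeFermat.KRFree.TheoremL HodgeFermat.KRFree.ThreeFibre

/-! ## Small facts about the middle third `M_n = {s : n < 3s < 2n}` -/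

/-- `Mid` is invariant under scaling level and residue by `g > 0` -/
lemma mid_mul (g n r : ℕ) (hg : 0 < g) : Mid (g * n) (g * r) ↔ Mid n r := by
  unfold Mid
  constructor
  · rintro ⟨h1, h2⟩
    constructor
    · by_contra h; push Not at h
      have := Nat.mul_le_mul_left g h
      rw [Nat.mul_comm g (3 * r)] at this
      nlinarith
    · by_contra h; push Not at h
      have := Nat.mul_le_mul_left g h
      nlinarith
  · rintro ⟨h1, h2⟩
    constructor
    · have := Nat.mul_lt_mul_of_pos_left h1 hg; nlinarith
    · have := Nat.mul_lt_mul_of_pos_left h2 hg; nlinarith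

/-- `⟨s(n − w)⟩_n = n − ⟨sw⟩_n` when `⟨sw⟩_n ≠ 0` -/
lemma neg_res (n s w : ℕ) (hn : 0 < n) (hw : w ≤ n) (hX : s * w % n ≠ 0) :
    s * (n - w) % n = n - s * w % n := by
  have hsum : s * (n - w) + s * w = s * n := by rw [← Nat.mul_add, Nat.sub_add_cancel hw]
  have hdvd : n ∣ s * (n - w) % n + s * w % n := by
    have h1 : (s * (n - w) + s * w) % n = 0 := by rw [hsum, Nat.mul_mod_left]
    have h2 := Nat.add_mod (s * (n - w)) (s * w) n
    rw [h1] at h2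
    exact Nat.dvd_of_mod_eq_zero h2.symm
  obtain ⟨k, hk⟩ := hdvd
  have hA : s * (n - w) % n < n := Nat.mod_lt _ hn
  have hB : s * w % n < n := Nat.mod_lt _ hn
  have hk2 : k < 2 := by
    by_contra hge; push Not at hge
    have := Nat.mul_le_mul_left n hge
    omega
  interval_cases k <;> omega

/-- a unit does not kill a unit -/
lemma unit_res_ne_zero {n s w : ℕ} (hn : 1 < n) (hs : Nat.Coprime s n) (hw : Nat.Coprime w n) :
    s * w % n ≠ 0 := by
  intro h
  have hd : n ∣ s * w := Nat.dvd_of_mod_eq_zero h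
  have hco : Nat.Coprime (s * w) n := Nat.Coprime.mul_left hs hw
  have : n ∣ 1 := by
    have := Nat.Coprime.eq_one_of_dvd (Nat.coprime_comm.mp hco) hd
    omega
  exact absurd (Nat.le_of_dvd Nat.one_pos this) (by omega)

/-! ## (a) the doubling argument -/

/-- `3ω < n` and `2^(j+1)·ω ∉ M_n` whenever `3·2^(j+1) < n` force `ω = 1` -/
lemma doubling (n ω : ℕ) (hn5 : 5 ≤ n) (h3n : ¬ 3 ∣ n) (hω0 : 0 < ω) (h3ω : 3 * ω < n)
    (hM : ∀ j : ℕ, 3 * 2 ^ (j + 1) < n → ¬ Mid n (2 ^ (j + 1) * ω % n)) : ω = 1 := by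
  have key : ∀ j, 3 * 2 ^ j < n → 3 * (2 ^ j * ω) < n := by
    intro j
    induction j with
    | zero => intro _; simpa using h3ω
    | succ j ih =>
      intro hj
      have e1 : (2 : ℕ) ^ (j + 1) = 2 * 2 ^ j := by ring
      have hj' : 3 * 2 ^ j < n := by rw [e1] at hj; omega
      have h1 := ih hj'
      have h2 := hM j hj
      have hlt : 2 ^ (j + 1) * ω < n := by rw [e1, mul_assoc]; omega
      rw [Nat.mod_eq_of_lt hlt, e1, mul_assoc] at h2
      unfold Mid at h2
      rw [e1, mul_assoc]
      omega
  have hex : ∃ j, n ≤ 3 * 2 ^ (j + 1) := by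
    refine ⟨n, ?_⟩
    have h := n.lt_two_pow_self
    have e1 : (2 : ℕ) ^ (n + 1) = 2 * 2 ^ n := by ring
    rw [e1]; omega
  obtain ⟨J, hJ, hJmin⟩ : ∃ J, n ≤ 3 * 2 ^ (J + 1) ∧ ∀ k, k < J → ¬ n ≤ 3 * 2 ^ (k + 1) :=
    ⟨Nat.find hex, Nat.find_spec hex, fun k hk => Nat.find_min hex hk⟩
  have hJ' : 3 * 2 ^ J < n := by
    rcases Nat.eq_zero_or_pos J with h0 | hpos
    · rw [h0]; omega
    · obtain ⟨k, hk⟩ := Nat.exists_eq_succ_of_ne_zero hpos.ne'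
      have hmin := hJmin k (by omega)
      rw [hk]; omega
  have h1 := key J hJ'
  have e1 : (2 : ℕ) ^ (J + 1) = 2 ^ J * 2 := by ring
  rw [e1] at hJ
  have h2 : 2 ^ J * ω < 2 ^ J * 2 := by omega
  have h3 := Nat.lt_of_mul_lt_mul_left h2
  omega

/-- **(a)** both entries units -/
lemma unit_case (n u v : ℕ) (hn5 : 5 ≤ n) (hodd : Odd n) (h3n : ¬ 3 ∣ n)
    (hu : Nat.Coprime u n) (hv : Nat.Coprime v n)
    (hM : ∀ t, Nat.Coprime t n → (Mid n (t * u % n) ↔ Mid n (t * v % n))) :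
    u ≡ v [MOD n] ∨ n ∣ u + v := by
  have hn1 : 1 < n := by omega
  obtain ⟨m, -, hm⟩ := Nat.exists_mul_mod_eq_one_of_coprime hu hn1
  have hm1 : u * m ≡ 1 [MOD n] := by unfold Nat.ModEq; rw [hm, Nat.mod_eq_of_lt hn1]
  have hum : Nat.Coprime (u * m) n := by
    unfold Nat.Coprime; rw [Nat.ModEq.gcd_eq hm1]; exact Nat.gcd_one_left n
  have hmco : Nat.Coprime m n := Nat.Coprime.coprime_mul_left hum
  have h2co : Nat.Coprime 2 n := Nat.coprime_two_left.mpr hodd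
  -- w = ⟨m v⟩, a unit
  obtain ⟨w, hw⟩ : ∃ w, m * v % n = w := ⟨_, rfl⟩
  have hmv : Nat.Coprime (m * v) n := Nat.Coprime.mul_left hmco hv
  have hw0 : 0 < w := by
    rw [← hw]; exact Nat.pos_of_ne_zero (unit_res_ne_zero hn1 hmco hv)
  have hwn : w < n := by rw [← hw]; exact Nat.mod_lt _ (by omega)
  have hwco : Nat.Coprime w n := by
    rw [← hw]
    have e : m * v % n ≡ m * v [MOD n] := Nat.mod_modEq _ _
    unfold Nat.Coprime; rw [Nat.ModEq.gcd_eq e]; exact hmv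
  -- transport: `⟨s⟩ ∈ M ⟺ ⟨s w⟩ ∈ M` for units `s`
  have hT : ∀ s, Nat.Coprime s n → (Mid n (s % n) ↔ Mid n (s * w % n)) := by
    intro s hs
    have h := hM (s * m) (Nat.Coprime.mul_left hs hmco)
    have e1 : s * m * u % n = s % n := by
      have := (hm1.mul_left s)
      unfold Nat.ModEq at this
      rw [show s * m * u = s * (u * m) by ring, this, mul_one]
    have e2 : s * m * v % n = s * w % n := by
      have := (Nat.mod_modEq (m * v) n).mul_left s
      unfold Nat.ModEq at this
      rw [show s * m * v = s * (m * v) by ring, ← this, hw]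
    rw [e1, e2] at h
    exact h
  -- s = 1: w ∉ M
  have h1 := hT 1 (Nat.coprime_one_left n)
  rw [Nat.mod_eq_of_lt hn1, one_mul, Nat.mod_eq_of_lt hwn] at h1
  have hw3 : 3 * w < n ∨ 2 * n < 3 * w := by unfold Mid at h1; omega
  -- conclusion from `w = 1` resp. `n − w = 1`
  rcases hw3 with h3w | h3w
  · -- w = 1 : u ≡ v
    have hw1 : w = 1 := by
      apply doubling n w hn5 h3n hw0 h3w
      intro j hj
      have hs : Nat.Coprime (2 ^ (j + 1)) n := Nat.Coprime.pow_left _ h2co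
      have h := hT _ hs
      have hlt : 2 ^ (j + 1) < n := by omega
      rw [Nat.mod_eq_of_lt hlt] at h
      have hnm : ¬ Mid n (2 ^ (j + 1)) := by unfold Mid; omega
      exact fun hm => hnm (h.mpr hm)
    left
    -- u ≡ u (m v) = (u m) v ≡ v
    have e : m * v ≡ 1 [MOD n] := by
      have := Nat.mod_modEq (m * v) n
      rw [hw, hw1] at this
      exact this.symm
    have h1' : u * (m * v) ≡ u * 1 [MOD n] := e.mul_left u
    have h2' : u * m * v ≡ 1 * v [MOD n] := hm1.mul_right v
    rw [mul_one] at h1'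
    rw [one_mul, mul_assoc] at h2'
    exact h1'.symm.trans h2'
  · -- n - w = 1 : u ≡ -v
    have hw1 : n - w = 1 := by
      apply doubling n (n - w) hn5 h3n (by omega) (by omega)
      intro j hj
      have hs : Nat.Coprime (2 ^ (j + 1)) n := Nat.Coprime.pow_left _ h2co
      have h := hT _ hs
      have hlt : 2 ^ (j + 1) < n := by omega
      rw [Nat.mod_eq_of_lt hlt] at h
      have hnm : ¬ Mid n (2 ^ (j + 1)) := by unfold Mid; omega
      have hX0 : 2 ^ (j + 1) * w % n ≠ 0 := unit_res_ne_zero hn1 hs hwco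
      have hXn : 2 ^ (j + 1) * w % n < n := Nat.mod_lt _ (by omega)
      rw [neg_res n _ w (by omega) hwn.le hX0]
      intro hm
      have hm' : Mid n (2 ^ (j + 1) * w % n) := by
        unfold Mid at hm ⊢; omega
      exact hnm (h.mpr hm')
    right
    -- n ∣ u + v : from u m ≡ 1, m v ≡ w = n - 1
    have hwv : m * v ≡ n - 1 [MOD n] := by
      have := Nat.mod_modEq (m * v) n
      rw [hw, show w = n - 1 by omega] at this
      exact this.symm
    have h1' : u * (m * v) ≡ u * (n - 1) [MOD n] := hwv.mul_left u
    have h2' : u * m * v ≡ 1 * v [MOD n] := hm1.mul_right v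
    rw [one_mul, mul_assoc] at h2'
    have h3' : v ≡ u * (n - 1) [MOD n] := h2'.symm.trans h1'
    have h4' : u + v ≡ u + u * (n - 1) [MOD n] := h3'.add_left u
    have e : u + u * (n - 1) = u * n := by
      zify [hn1.le]
      ring
    rw [e] at h4'
    exact (Nat.modEq_zero_iff_dvd.mp (h4'.trans (Nat.modEq_zero_iff_dvd.mpr (Nat.dvd_mul_left n u))))


end HodgeFermat.KRFree.ThreePointwise
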